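import Summits.HodgeConjecture.HodgeConjecture.Theorems.Ring2AbelianAllAndreFibreClassPrimitiveParts
import Literature.AlgebraicGeometry.HodgeTheory.InvariantClassesFromTotalSpaceHolds
import Literature.AlgebraicGeometry.HodgeTheory.AlgebraicClassesPullbackDimLEThree
import HarnessLib

/-!
# Ring 2 · AbelianAll — ANDRÉ AXIS, PART U-0 (ab-andre-2, gen 52): THE RESTRICTION IMAGES SATISFY HARD LEFSCHETZ —
  `j_t^* H^{k+2j}(𝒳) = L^j_{K_t} · j_t^* H^k(𝒳)` for `k + j ≥ d`, FACT-FREE; complementary degrees die together; the outer odd cell is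
  read in the degrees BELOW the middle (the memo's `stub_outer_one` becomes a theorem in part U-j)

HONEST FRAMING (page 1, verbatim): **research route, not a corollary; conditional on HC_CM plus one named minimal statement.** Cell line:
research route conditional on HC_CM; not a corollary; Q11.4-sentence-2 already refuted in dim ≥ 3. Nothing in this file is Hodge-theoretic
beyond the tree's PROVED «invariant classes come from the total space» (`deligne1968_invariantClass_fromTotalSpace_holds`); nothing proves a
case of the Hodge conjecture or of `B(X)`; `HC_CM`, `HC_AV`, the global nodes, Verdier ABSENT; 0 `def`, 0 `sorry`, 0 named fact. Item
`Theses.RankFourFaces.CMToAbelian` (stmt-16267) stays OPEN; N104 untouched. Seat `pub-hodge-ring2-ab-andre-2`, gen 52 (own addition to PART U).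

## Content (theorems only; standard axioms)

For a compact pencil `f : 𝒳 ⟶ S` of abelian `d`-folds, a member `t`, and a global class `K ∈ H²(𝒳(ℂ); ℂ)` with the hard Lefschetz property
on every fibre (such a `K` exists, part XII-a `exists_globalKaehlerClass`):
* §1 **`exists_map_fiberι_eq_lefschetzPowTo_map_fiberι`** — for `k + 2j = m` with `k + j ≥ d`, EVERY restricted class `W|_{X_t}`,
  `W ∈ Hᵐ(𝒳(ℂ); ℂ)`, is `L^j_{K|X_t} (B|_{X_t})` for a GLOBAL `B ∈ Hᵏ(𝒳(ℂ); ℂ)`: in the Lefschetz decomposition of `W|_{X_t}` every index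
  `(a, r)` with a non-zero summand has `r ≥ j` (`a + r ≤ d`), and each primitive part is the restriction of a global class (part XII-a
  `exists_primitivePart_map_fiberι_eq`, now fed with the tree's PROOF of Deligne 1968 / Voisin II Thm. 4.18), so
  `B := ∑_{(a,r)} L^{r−j}_K B_{(a,r)}` works (`map_lefschetzPowTo`, `lefschetzPowTo_lefschetzPowTo`). In print: the invariant local system
  `(R^• f_* ℂ)^{π₁}` is a sub-`sl₂`-module, so `L^j : (Rᵏ)^{inv} ⥲ (R^{2d−k})^{inv}`, and invariants = restrictions (Deligne).
* §2 **`exists_map_fiberι_ne_zero_of_map_fiberι_ne_zero`** (a class surviving in degree `m` yields one surviving in degree `k`, `k + j ≥ d`),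
  **`forall_map_fiberι_eq_zero_of_forall_map_fiberι_eq_zero`** (if every global class of degree `k` dies on `X_t` then so does every global
  class of degree `k + 2j`, `k + j ≥ d`; hypothesis-free: the polarising `K` is produced inside), and at the symmetric degree
  **`forall_map_fiberι_eq_zero_iff_of_add_eq`** (`k + j = d`: the global classes of degrees `k` and `2d − k` die on `X_t` TOGETHER — the
  converse by the injectivity of `L^{d−k}_{K|X_t}` on `Hᵏ(X_t)`).
These are the inputs of part U-j: the outer odd cell `OddOuterRestrictionsVanishAt f d t` is decided in the odd degrees `< d`, at `d = 3` by
`j_t^* H¹(𝒳) = 0` alone, and the memo's `stub_outer_one` (`¬ outer-vanishing ⟹ ∃ W ∈ H¹(𝒳), j_t^* W ≠ 0`) is a THEOREM.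

## Honest status

Fact-free consequences of the tree's PROVED global invariant cycle input (Voisin II Thm. 4.18 on the étalé carriers) and the Lefschetz
decomposition on the fibres; in print this is «the monodromy invariants satisfy hard Lefschetz» (Deligne 1968 (2.9); Voisin II 4.2.3). Nothing
minimal claimed; the open instances of the axis are unchanged; N104 untouched. EDGE LABELS: §1–§2 K (fact-free).
References: Deligne1968 (Thm. 1.5, (2.9)); VoisinHodgeII2003 (Thm. 4.15, 4.18, §4.2.3); VoisinHodgeI2002 (Cor. 6.26, Thm. 6.25);
DeligneHodgeII1971 (Thm. 4.1.1); Tankeev2003 (Remark 2.7: the outer odd invariants of a threefold pencil).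
-/

noncomputable section

set_option linter.dupNamespace false

namespace Summit.HodgeConjecture.HodgeConjecture.Ring2.AbelianAll

open CategoryTheory AlgebraicGeometry
open Literature.AlgebraicGeometry Literature.AlgebraicGeometry.Motives
open Literature.AlgebraicGeometry.HodgeTheory
open Literature.Geometry.Kaehler (HasHardLefschetzProperty)

variable {𝒳 S : SchemeOver ℂ}

/-! ## §1 Every restricted class of degree `k + 2j`, `k + j ≥ d`, is `Lʲ` of a restricted class of degree `k` -/

/-- **The restriction images satisfy hard Lefschetz (existence form).** For a compact pencil `f : 𝒳 ⟶ S` of abelian `d`-folds, a global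
`K ∈ H²(𝒳(ℂ); ℂ)` with the hard Lefschetz property on every fibre, degrees `k + 2j = m` with `d ≤ k + j`, a member `t` and a global class
`W ∈ Hᵐ(𝒳(ℂ); ℂ)`: there is a global `B ∈ Hᵏ(𝒳(ℂ); ℂ)` with `W|_{X_t} = L^j_{K|X_t} (B|_{X_t})`. Proof: Lefschetz-decompose
`W|_{X_t} = ∑_{a+2r=m} Lʳ ξ_{(a,r)}` (`sum_lefschetzPowTo_primitivePart`); the summands with `a + r > d` vanish (`primitivePart_of_lt`), the
others have `r ≥ j`; each `ξ_{(a,r)}` is the restriction of a global class `B_{(a,r)} ∈ Hᵃ(𝒳)` (part XII-a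
`exists_primitivePart_map_fiberι_eq` with the tree's proof `deligne1968_invariantClass_fromTotalSpace_holds`), and
`B := ∑ L_K^{r−j} B_{(a,r)}`. [cite: VoisinHodgeII2003, Thm. 4.18 and §4.2.3] [cite: Deligne1968, Thm. 1.5 and (2.9)]
[cite: VoisinHodgeI2002, §6.2.3 Cor. 6.26] -/
theorem exists_map_fiberι_eq_lefschetzPowTo_map_fiberι {d : ℕ} {f : 𝒳 ⟶ S} (hf : IsCompactAbelianPencil f d)
    (K : complexBetti 𝒳 2) (hK : ∀ s : ComplexPoints S, HasHardLefschetzProperty (complexBetti.map (fiberι f s) 2 K) d)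
    {k j m : ℕ} (hm : k + 2 * j = m) (hkj : d ≤ k + j) (t : ComplexPoints S) (W : complexBetti 𝒳 m) :
    ∃ B : complexBetti 𝒳 k, complexBetti.map (fiberι f t) m W =
      lefschetzPowTo (complexBetti.map (fiberι f t) 2 K) j k m hm (complexBetti.map (fiberι f t) k B) := by
  classical
  -- the primitive parts of `W|_{X_t}` are restrictions of global classes
  choose Bp hBp using fun p : {p : ℕ × ℕ // p.1 + 2 * p.2 = m} ↦
    exists_primitivePart_map_fiberι_eq deligne1968_invariantClass_fromTotalSpace_holds hf K hK W p t
  -- the global class `B := ∑_{(a,r), j ≤ r} L_K^{r-j} B_{(a,r)}`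
  let G : {p : ℕ × ℕ // p.1 + 2 * p.2 = m} → complexBetti 𝒳 k := fun p ↦
    if hp : j ≤ p.1.2 then lefschetzPowTo K (p.1.2 - j) p.1.1 k (by have := p.2; omega) (Bp p) else 0
  refine ⟨∑ p, G p, ?_⟩
  rw [map_sum, map_sum, ← sum_lefschetzPowTo_primitivePart (hK t) (hvan_fiberOver hf t) (complexBetti.map (fiberι f t) m W)]
  refine Finset.sum_congr rfl fun p _ ↦ ?_
  by_cases hp : j ≤ p.1.2
  · -- `Lʳ ξ_p = Lʲ (L^{r-j} (B_p|X_t)) = Lʲ ((L_K^{r-j} B_p)|X_t)`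
    have hG : G p = lefschetzPowTo K (p.1.2 - j) p.1.1 k (by have := p.2; omega) (Bp p) := dif_pos hp
    rw [hG, map_lefschetzPowTo (fiberι f t) K (p.1.2 - j) p.1.1 k _ (Bp p), ← hBp p,
      lefschetzPowTo_lefschetzPowTo (complexBetti.map (fiberι f t) 2 K) j (by have := p.2; omega) hm (by have := p.2; omega)]
    exact lefschetzPowTo_congr_exponent _ (by omega) _ _ _
  · -- `r < j` forces `a + r > d`, so the summand vanishes
    have hG : G p = 0 := dif_neg hp
    have hlt : d < p.1.1 + p.1.2 := by have := p.2; omega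
    rw [hG, map_zero, LinearMap.map_zero, primitivePart_of_lt (hK t) (hvan_fiberOver hf t) p hlt, LinearMap.zero_apply,
      LinearMap.map_zero]

/-! ## §2 Consequences: surviving classes in the lower degree; complementary degrees die together -/

/-- **A class surviving on `X_t` in degree `k + 2j`, `k + j ≥ d`, yields a global class of degree `k` surviving on `X_t`** (with `K` as in §1).
[cite: VoisinHodgeII2003, Thm. 4.18 and §4.2.3] [cite: Deligne1968, (2.9)] -/
theorem exists_map_fiberι_ne_zero_of_map_fiberι_ne_zero {d : ℕ} {f : 𝒳 ⟶ S} (hf : IsCompactAbelianPencil f d)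
    (K : complexBetti 𝒳 2) (hK : ∀ s : ComplexPoints S, HasHardLefschetzProperty (complexBetti.map (fiberι f s) 2 K) d)
    {k j m : ℕ} (hm : k + 2 * j = m) (hkj : d ≤ k + j) (t : ComplexPoints S) {W : complexBetti 𝒳 m}
    (hW : complexBetti.map (fiberι f t) m W ≠ 0) :
    ∃ B : complexBetti 𝒳 k, complexBetti.map (fiberι f t) k B ≠ 0 := by
  obtain ⟨B, hB⟩ := exists_map_fiberι_eq_lefschetzPowTo_map_fiberι hf K hK hm hkj t W
  refine ⟨B, fun h0 ↦ hW ?_⟩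
  rw [hB, h0, LinearMap.map_zero]

/-- **If every global class of degree `k` dies on `X_t`, so does every global class of degree `k + 2j`, `k + j ≥ d`** — hypothesis-free
(the polarising global class is produced by part XII-a `exists_globalKaehlerClass`; for `d = 0` the fibre cohomology vanishes in positive
degree). [cite: VoisinHodgeII2003, Thm. 4.18 and §4.2.3] [cite: Deligne1968, (2.9)] [cite: DeligneHodgeII1971, Thm. 4.1.1] -/
theorem forall_map_fiberι_eq_zero_of_forall_map_fiberι_eq_zero {d : ℕ} {f : 𝒳 ⟶ S} (hf : IsCompactAbelianPencil f d)
    {k j m : ℕ} (hm : k + 2 * j = m) (hkj : d ≤ k + j) (t : ComplexPoints S)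
    (hk : ∀ B : complexBetti 𝒳 k, complexBetti.map (fiberι f t) k B = 0) (W : complexBetti 𝒳 m) :
    complexBetti.map (fiberι f t) m W = 0 := by
  rcases Nat.eq_zero_or_pos d with rfl | hd
  · -- `d = 0`: either `m = k` (then `hk`), or `m > 0 = 2·0` and `Hᵐ(X_t) = 0`
    rcases Nat.eq_zero_or_pos m with rfl | hmpos
    · obtain rfl : k = 0 := by omega
      exact hk W
    · haveI := hvan_fiberOver hf t m (by omega)
      exact Subsingleton.elim _ _
  · obtain ⟨K, -, -, hK⟩ := exists_globalKaehlerClass hf hd t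
    by_contra hW
    obtain ⟨B, hB⟩ := exists_map_fiberι_ne_zero_of_map_fiberι_ne_zero hf K hK hm hkj t hW
    exact hB (hk B)

/-- **Complementary degrees die together.** For `k + j = d` (so `m = k + 2j = 2d − k`): every global class of degree `k` dies on `X_t` IFF
every global class of degree `2d − k` does — `⟹` by §1, `⟸` because `L^j_{K|X_t} : Hᵏ(X_t) → H^{2d−k}(X_t)` is injective (hard Lefschetz
on the fibre) and `L^j (B|X_t) = (L_K^j B)|X_t`. [cite: VoisinHodgeII2003, Thm. 4.18 and §4.2.3] [cite: VoisinHodgeI2002, Thm. 6.25]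
[cite: Deligne1968, (2.9)] -/
theorem forall_map_fiberι_eq_zero_iff_of_add_eq {d : ℕ} {f : 𝒳 ⟶ S} (hf : IsCompactAbelianPencil f d)
    {k j m : ℕ} (hm : k + 2 * j = m) (hkj : k + j = d) (t : ComplexPoints S) :
    (∀ B : complexBetti 𝒳 k, complexBetti.map (fiberι f t) k B = 0) ↔
      ∀ W : complexBetti 𝒳 m, complexBetti.map (fiberι f t) m W = 0 := by
  refine ⟨fun hk W ↦ forall_map_fiberι_eq_zero_of_forall_map_fiberι_eq_zero hf hm hkj.ge t hk W, fun hmW B ↦ ?_⟩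
  rcases Nat.eq_zero_or_pos d with rfl | hd
  · obtain rfl : k = 0 := by omega
    obtain rfl : j = 0 := by omega
    subst hm
    exact hmW B
  · obtain ⟨K, -, -, hK⟩ := exists_globalKaehlerClass hf hd t
    have hinj := (bijective_lefschetzPowTo_of_hasHardLefschetz (complexBetti.map (fiberι f t) 2 K) (hK t) hkj m hm).1
    apply hinj
    rw [LinearMap.map_zero, ← map_lefschetzPowTo (fiberι f t) K j k m hm B]
    exact hmW _

/-! ## §3 (appended, ab-andre-2 gen 52) Submodule form: `Lʲ (j_t^* Hᵏ) = j_t^* H^{k+2j}`; the invariant Betti numbers are Lefschetz-symmetric -/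

/-- **`Lʲ_{K|X_t} (j_t^* Hᵏ(𝒳)) = j_t^* H^{k+2j}(𝒳)` as subspaces of `H^{k+2j}(X_t)`, for `k + j ≥ d`** (the submodule form of §1; `⊆` by
naturality of `Lʲ`, `⊇` by `exists_map_fiberι_eq_lefschetzPowTo_map_fiberι`). [cite: VoisinHodgeII2003, Thm. 4.18 and §4.2.3] [cite: Deligne1968, (2.9)] -/
theorem map_lefschetzPowTo_range_map_fiberι_eq {d : ℕ} {f : 𝒳 ⟶ S} (hf : IsCompactAbelianPencil f d)
    (K : complexBetti 𝒳 2) (hK : ∀ s : ComplexPoints S, HasHardLefschetzProperty (complexBetti.map (fiberι f s) 2 K) d)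
    {k j m : ℕ} (hm : k + 2 * j = m) (hkj : d ≤ k + j) (t : ComplexPoints S) :
    (LinearMap.range (complexBetti.map (fiberι f t) k).hom).map (lefschetzPowTo (complexBetti.map (fiberι f t) 2 K) j k m hm) =
      LinearMap.range (complexBetti.map (fiberι f t) m).hom := by
  apply le_antisymm
  · rintro _ ⟨_, ⟨B, rfl⟩, rfl⟩
    refine ⟨lefschetzPowTo K j k m hm B, ?_⟩
    change complexBetti.map (fiberι f t) m (lefschetzPowTo K j k m hm B) =
      lefschetzPowTo (complexBetti.map (fiberι f t) 2 K) j k m hm (complexBetti.map (fiberι f t) k B)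
    exact map_lefschetzPowTo (fiberι f t) K j k m hm B
  · rintro _ ⟨W, rfl⟩
    obtain ⟨B, hB⟩ := exists_map_fiberι_eq_lefschetzPowTo_map_fiberι hf K hK hm hkj t W
    refine ⟨complexBetti.map (fiberι f t) k B, ⟨B, rfl⟩, ?_⟩
    change lefschetzPowTo (complexBetti.map (fiberι f t) 2 K) j k m hm (complexBetti.map (fiberι f t) k B) =
      complexBetti.map (fiberι f t) m W
    exact hB.symm

/-- **The invariant Betti numbers of a member are Lefschetz-symmetric**: for `k + j = d`, the ranks of the restriction maps
`j_t^* : Hᵏ(𝒳) → Hᵏ(X_t)` and `j_t^* : H^{2d−k}(𝒳) → H^{2d−k}(X_t)` agree (`L^{d−k}_{K|X_t}` is injective on `Hᵏ(X_t)` and carries one image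
onto the other; hypothesis-free). In print: `dim H^k(X_t)^{π₁} = dim H^{2d−k}(X_t)^{π₁}` (invariants = restrictions, Deligne).
[cite: VoisinHodgeII2003, Thm. 4.18 and §4.2.3] [cite: VoisinHodgeI2002, Thm. 6.25] [cite: DeligneHodgeII1971, Thm. 4.1.1] -/
theorem finrank_range_map_fiberι_eq_of_add_eq {d : ℕ} {f : 𝒳 ⟶ S} (hf : IsCompactAbelianPencil f d)
    {k j m : ℕ} (hm : k + 2 * j = m) (hkj : k + j = d) (t : ComplexPoints S) :
    Module.finrank ℂ (LinearMap.range (complexBetti.map (fiberι f t) k).hom) =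
      Module.finrank ℂ (LinearMap.range (complexBetti.map (fiberι f t) m).hom) := by
  rcases Nat.eq_zero_or_pos d with rfl | hd
  · obtain rfl : k = 0 := by omega
    obtain rfl : j = 0 := by omega
    subst hm
    rfl
  · obtain ⟨K, -, -, hK⟩ := exists_globalKaehlerClass hf hd t
    rw [← map_lefschetzPowTo_range_map_fiberι_eq hf K hK hm hkj.ge t]
    exact LinearEquiv.finrank_eq (Submodule.equivMapOfInjective _
      (bijective_lefschetzPowTo_of_hasHardLefschetz (complexBetti.map (fiberι f t) 2 K) (hK t) hkj m hm).1 _)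

end Summit.HodgeConjecture.HodgeConjecture.Ring2.AbelianAll

end
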